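import Summits.CriticalPhenomena.PercolationContinuityZ3.Theorems.Transplant.FKDoubleFanMultifan
import Summits.CriticalPhenomena.PercolationContinuityZ3.Theorems.Transplant.FKDoubleFanOneSidedRays
import Summits.CriticalPhenomena.PercolationContinuityZ3.Theorems.Transplant.FKThreeApexT3Envelope
import HarnessLib

/-!
# Double fans, MULTIFAN₁ middles: the four-leg Rayleigh difference as a PAIRING OF TWO DRESSED BIVECTORS, and its fibre-affinity in
# the two fan legs (the reduction step of LEMMA‴ to endpoint legs)

Helper file (`--supports stmt-CriticalPhenomena-4575`), FK sub-lane `prim-bschramm-fk-3` (gen 34); builds on p205010 (kernel theorem, internal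
audit signed; external expert review pending).  Pure real algebra, no sorries; standard axioms.  Memo `bschramm/prim-bschramm-fk-3/FAR-CROSS-IX.md` §5–§6.

`…DoubleFanMultifan` reduced cross-apex negative correlation for every middle whose `a`-spokes precede its `b`-spokes to LEMMA‴:
`mfZ¹⁰·mfZ⁰¹ − mfZ¹¹·mfZ⁰⁰ ≥ 0` on `InKE⁴`, `mfZ q F G u s σ τ = val_q(s ∗ BC_τ ∗ fanComboB G (fanCombo F (AC_σ ∗ u)))`.  This file puts LEMMA‴ into the
shape in which the certificate technique of `…OneSidedRays/…OneSidedProducts` applies: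
* **`fanComboBrev`** — the REVERSED `b`-fan word (`G_ac·id + G₁·P_b + G₀·detach + G_ab·(P_b ∘ detach) + G_bc·(detach ∘ P_b)`) — is the adjoint of `fanComboB`
  for the gluing form: **`val_conv_fanComboB`** `val_q(Y ∗ fanComboB G W) = val_q(fanComboBrev G Y ∗ W)` (the rim step and the spokes are self-adjoint);
* **`mfZ_rayleigh_eq_pairH`**: the four-leg Rayleigh difference is `q²·⟪(G-dressed target), (F-dressed input)⟫`:
  `= q²·pairH (wedgeH (fanComboBrev G (s ∗ BC_1)) (fanComboBrev G s)) (wedgeH (fanCombo F (AC_1 ∗ u)) (fanCombo F u))` — a bilinear pairing of the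
  `a`-dressed input bivector (quadratic in `F`, hat products of `u`) with the `b`-dressed target bivector (quadratic in `G`, hat products of `s`);
* **FIBRE-AFFINITY** (the mechanism: the fibre direction of the fan leg is `detach ∘ P_a^⊥`, which kills the pinned vector `P_a u`):
  **`fanCombo_fibre_pinned`** (`fanCombo ⟨u₀, y−u₀, Z, X, Z₁⟩ (AC_1 ∗ W)` does not depend on `u₀`), **`wedgeH_fanCombo_fibre`** (the dressed input bivector is
  AFFINE along the fibre `u₀ ↦ ⟨u₀, y−u₀, Z, X, Z₁⟩`, i.e. `z0 ↔ zab`), and the mirror statements **`fanComboBrev_fibre_pinned`**, **`wedgeH_fanComboBrev_fibre`**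
  for the `G`-leg along `z0 ↔ zbc`; hence (**`mfRayleigh_fibreF_affine`**, **`mfRayleigh_fibreG_affine`**) the four-leg Rayleigh difference is affine along both fan
  fibres — exactly the hypothesis `haff` of the generic ray lemma `vecB_nonneg_of_rays_gen`, so LEMMA‴ on the relaxation `Valid ∧ U` reduces to the endpoint legs
  (degenerate / floor / roof for `F` and `G`, rays `A, D, AC, BD, 𝟙` and `roofP` for `u` and `s`; memo §6: 190 of the 324 cells are tensor-Bernstein certified,
  120 vanish, the rest are `CORE4` (1,863 terms), two CORE-sized polynomials and a dozen small SOS forms).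
[cite: Grimmett2006, §3.9 eq. (3.94) (pp. 63–64)] [folklore]
-/

noncomputable section

namespace Summit.CriticalPhenomena.PercolationContinuityZ3.Theorems

namespace FK

namespace ThreeApex

/-! ### The reversed `b`-fan word and adjointness -/

/-- The REVERSED `b`-fan word applied to `Y`: `G_ac·Y + G₁·P_b Y + G₀·detach Y + G_ab·P_b (detach Y) + G_bc·detach (P_b Y)` (each monomial of
`fanComboB` read backwards). [folklore] -/
def fanComboBrev (q : ℝ) (G Y : V5) : V5 :=
  ⟨G.zac * Y.z0 + G.z1 * (conv (edgeBC 1) Y).z0 + G.z0 * (detach q Y).z0 + G.zab * (conv (edgeBC 1) (detach q Y)).z0 +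
      G.zbc * (detach q (conv (edgeBC 1) Y)).z0,
    G.zac * Y.zab + G.z1 * (conv (edgeBC 1) Y).zab + G.z0 * (detach q Y).zab + G.zab * (conv (edgeBC 1) (detach q Y)).zab +
      G.zbc * (detach q (conv (edgeBC 1) Y)).zab,
    G.zac * Y.zac + G.z1 * (conv (edgeBC 1) Y).zac + G.z0 * (detach q Y).zac + G.zab * (conv (edgeBC 1) (detach q Y)).zac +
      G.zbc * (detach q (conv (edgeBC 1) Y)).zac,
    G.zac * Y.zbc + G.z1 * (conv (edgeBC 1) Y).zbc + G.z0 * (detach q Y).zbc + G.zab * (conv (edgeBC 1) (detach q Y)).zbc +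
      G.zbc * (detach q (conv (edgeBC 1) Y)).zbc,
    G.zac * Y.z1 + G.z1 * (conv (edgeBC 1) Y).z1 + G.z0 * (detach q Y).z1 + G.zab * (conv (edgeBC 1) (detach q Y)).z1 +
      G.zbc * (detach q (conv (edgeBC 1) Y)).z1⟩

/-- **Adjointness**: `val_q(Y ∗ fanComboB G W) = val_q(fanComboBrev G Y ∗ W)` — the rim step (`detach`) and the spoke `P_b` are self-adjoint for the gluing
form `val_q(· ∗ ·)`, so a word is adjoint to its reversal. [folklore] -/
theorem val_conv_fanComboB (q : ℝ) (G Y W : V5) : val q (conv Y (fanComboB q G W)) = val q (conv (fanComboBrev q G Y) W) := by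
  simp only [val, conv, fanComboB, fanComboBrev, detach, edgeBC, V5.total]; ring

/-- **The four pinned partition functions through the two dressings**: `mfZ q F G u s σ τ = val_q(fanComboBrev G (s ∗ BC_τ) ∗ fanCombo F (AC_σ ∗ u))`. [folklore] -/
theorem mfZ_eq_dressed (q : ℝ) (F G u s : V5) (σ τ : ℝ) :
    mfZ q F G u s σ τ = val q (conv (fanComboBrev q G (conv s (edgeBC τ))) (fanCombo q F (conv (edgeAC σ) u))) := by
  simp only [mfZ]
  rw [← conv_assoc', val_conv_fanComboB]

/-- **LEMMA‴'s form as a bivector pairing**: the four-leg Rayleigh difference is `q²·⟪G-dressed target, F-dressed input⟫`. [folklore] -/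
theorem mfZ_rayleigh_eq_pairH (q : ℝ) (F G u s : V5) :
    mfZ q F G u s 1 0 * mfZ q F G u s 0 1 - mfZ q F G u s 1 1 * mfZ q F G u s 0 0 =
      q ^ 2 * pairH q (wedgeH (fanComboBrev q G (conv s (edgeBC 1))) (fanComboBrev q G s))
        (wedgeH (fanCombo q F (conv (edgeAC 1) u)) (fanCombo q F u)) := by
  simp only [mfZ_eq_dressed, conv_edgeAC_zero, conv_edgeBC_zero_right']
  rw [← rayleigh_eq_pairH]
  ring

/-! ### Fibre-affinity of the dressed input (the `F`-leg, fibre `z0 ↔ zab`) -/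

/-- The `F`-leg point of the apex frame with fibre coordinate `u₀`: `⟨u₀, y − u₀, Z, X, Z₁⟩` (`= swapAC (swapAB (vecB q W y X Z u₀))` with `Z₁ = W − qy − X − Z`). [folklore] -/
def legF (u0 y Z X Z1 : ℝ) : V5 := ⟨u0, y - u0, Z, X, Z1⟩

/-- `legF` is the `F`-leg reading of the apex-`b` frame. [folklore] -/
theorem legF_eq_vecB (q W y X Z u0 : ℝ) : legF u0 y Z X (W - q * y - X - Z) = swapAC (swapAB (vecB q W y X Z u0)) := by
  ext <;> simp [legF, vecB, swapAB, swapAC]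

/-- **The fibre direction kills the pinned input**: `fanCombo ⟨u₀, y−u₀, Z, X, Z₁⟩ (AC_1 ∗ W)` does not depend on `u₀` (the direction is `detach ∘ (id − P_a)`
and `P_a` is idempotent). [folklore] -/
theorem fanCombo_fibre_pinned (q a b y Z X Z1 : ℝ) (W : V5) :
    fanCombo q (legF a y Z X Z1) (conv (edgeAC 1) W) = fanCombo q (legF b y Z X Z1) (conv (edgeAC 1) W) := by
  ext <;> simp only [fanCombo, legF, conv, edgeAC, detach, V5.total] <;> ring

/-- **The dressed input bivector is affine along the `F`-fibre.** [folklore] -/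
theorem wedgeH_fanCombo_fibre (q a b c y Z X Z1 : ℝ) (W : V5) :
    wedgeH (fanCombo q (legF (c * a + (1 - c) * b) y Z X Z1) (conv (edgeAC 1) W)) (fanCombo q (legF (c * a + (1 - c) * b) y Z X Z1) W) =
      Biv.lin3 c (wedgeH (fanCombo q (legF a y Z X Z1) (conv (edgeAC 1) W)) (fanCombo q (legF a y Z X Z1) W))
        (1 - c) (wedgeH (fanCombo q (legF b y Z X Z1) (conv (edgeAC 1) W)) (fanCombo q (legF b y Z X Z1) W)) 0 (wedgeH W W) := by
  ext <;> simp only [wedgeH, fanCombo, legF, conv, edgeAC, detach, V5.total, hx, hy, hz, Biv.lin3, Biv.add, Biv.smul] <;> ring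

/-- `pairH` is linear in its SECOND argument along `lin3` (companion of `pairH_lin3`). [folklore] -/
theorem pairH_comm_lin3 (q a b c : ℝ) (β γ δ ε : Biv) :
    pairH q ε (Biv.lin3 a β b γ c δ) = a * pairH q ε β + b * pairH q ε γ + c * pairH q ε δ := by
  simp only [pairH, Biv.lin3, Biv.add, Biv.smul]; ring

/-- **The four-leg Rayleigh difference is affine along the `F`-fibre** (hypothesis `haff` of `vecB_nonneg_of_rays_gen` for the `F`-leg). [folklore] -/
theorem mfRayleigh_fibreF_affine (q : ℝ) (G u s : V5) (W y X Z a b c : ℝ) :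
    (fun F : V5 => mfZ q F G u s 1 0 * mfZ q F G u s 0 1 - mfZ q F G u s 1 1 * mfZ q F G u s 0 0)
        (swapAC (swapAB (vecB q W y X Z (c * a + (1 - c) * b)))) =
      c * (fun F : V5 => mfZ q F G u s 1 0 * mfZ q F G u s 0 1 - mfZ q F G u s 1 1 * mfZ q F G u s 0 0) (swapAC (swapAB (vecB q W y X Z a))) +
      (1 - c) * (fun F : V5 => mfZ q F G u s 1 0 * mfZ q F G u s 0 1 - mfZ q F G u s 1 1 * mfZ q F G u s 0 0)
        (swapAC (swapAB (vecB q W y X Z b))) := by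
  simp only [mfZ_rayleigh_eq_pairH, ← legF_eq_vecB, wedgeH_fanCombo_fibre q a b c, pairH_comm_lin3]
  ring

/-! ### Fibre-affinity of the dressed target (the `G`-leg, fibre `z0 ↔ zbc`) -/

/-- The `G`-leg point with fibre coordinate `v₀`: `⟨v₀, X, Z, y − v₀, Z₁⟩` (`= swapAC` of the `F`-leg reading: the `b`-fan is the `a ↔ c` mirror). [folklore] -/
def legG (v0 y Z X Z1 : ℝ) : V5 := ⟨v0, X, Z, y - v0, Z1⟩

/-- `legG` is `swapAC` of `legF`. [folklore] -/
theorem legG_eq (v0 y Z X Z1 : ℝ) : legG v0 y Z X Z1 = swapAC (legF v0 y Z X Z1) := by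
  ext <;> simp [legG, legF, swapAC]

/-- **The `G`-fibre direction kills the pinned target**: `fanComboBrev ⟨v₀, X, Z, y−v₀, Z₁⟩ (Y ∗ BC_1)` does not depend on `v₀`. [folklore] -/
theorem fanComboBrev_fibre_pinned (q a b y Z X Z1 : ℝ) (Y : V5) :
    fanComboBrev q (legG a y Z X Z1) (conv Y (edgeBC 1)) = fanComboBrev q (legG b y Z X Z1) (conv Y (edgeBC 1)) := by
  ext <;> simp only [fanComboBrev, legG, conv, edgeBC, detach, V5.total] <;> ring

/-- **The dressed target bivector is affine along the `G`-fibre.** [folklore] -/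
theorem wedgeH_fanComboBrev_fibre (q a b c y Z X Z1 : ℝ) (Y : V5) :
    wedgeH (fanComboBrev q (legG (c * a + (1 - c) * b) y Z X Z1) (conv Y (edgeBC 1))) (fanComboBrev q (legG (c * a + (1 - c) * b) y Z X Z1) Y) =
      Biv.lin3 c (wedgeH (fanComboBrev q (legG a y Z X Z1) (conv Y (edgeBC 1))) (fanComboBrev q (legG a y Z X Z1) Y))
        (1 - c) (wedgeH (fanComboBrev q (legG b y Z X Z1) (conv Y (edgeBC 1))) (fanComboBrev q (legG b y Z X Z1) Y)) 0 (wedgeH Y Y) := by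
  ext <;> simp only [wedgeH, fanComboBrev, legG, conv, edgeBC, detach, V5.total, hx, hy, hz, Biv.lin3, Biv.add, Biv.smul] <;> ring

/-- **The four-leg Rayleigh difference is affine along the `G`-fibre** (`G = swapAC (swapAC (swapAB (vecB …)))`-reading: `legG`). [folklore] -/
theorem mfRayleigh_fibreG_affine (q : ℝ) (F u s : V5) (y X Z Z1 a b c : ℝ) :
    (fun G : V5 => mfZ q F G u s 1 0 * mfZ q F G u s 0 1 - mfZ q F G u s 1 1 * mfZ q F G u s 0 0) (legG (c * a + (1 - c) * b) y Z X Z1) =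
      c * (fun G : V5 => mfZ q F G u s 1 0 * mfZ q F G u s 0 1 - mfZ q F G u s 1 1 * mfZ q F G u s 0 0) (legG a y Z X Z1) +
      (1 - c) * (fun G : V5 => mfZ q F G u s 1 0 * mfZ q F G u s 0 1 - mfZ q F G u s 1 1 * mfZ q F G u s 0 0) (legG b y Z X Z1) := by
  simp only [mfZ_rayleigh_eq_pairH, wedgeH_fanComboBrev_fibre q a b c, pairH_lin3]
  ring

end ThreeApex

end FK

end Summit.CriticalPhenomena.PercolationContinuityZ3.Theorems
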